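import Summits.ResolutionOfSingularities.ResolutionOfSingularities.Theorems.WeightedInvariantWeightedConstructionFatPointProfileBound
import Summits.ResolutionOfSingularities.ResolutionOfSingularities.Theorems.WeightedInvariantWeightedConstructionWeightedChartBasicOpen
import Summits.ResolutionOfSingularities.ResolutionOfSingularities.Theorems.WeightedInvariantWeightedConstructionFormalStrictTransform

/-!
# Fat points: every admissible profile at the origin of `(𝔸ⁿ, 𝔪₀²)` is at most `(2,…,2,⊤,…)`

[OURS · L1 W4.3 · chain w43, stub worker 4] Scheme-level form of the fat-point upper bound
(`Theorems/WeightedInvariantWeightedConstructionFatPointProfileBound.lean`) for the hull-escape family of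
line `pointwise-lexmax-hull`, crux `WeightedConstruction` (stmt-ResolutionOfSingularities-0571).
NOT a statement of any manuscript.

On `Y = Spec k[x₁,…,xₙ]` with `X` the ideal sheaf of `𝔪₀²` (`𝔪₀ = ker (constant coefficient)`, the
origin), EVERY profile that is admissible at the origin in the sense of the line's
`AdmissibleProfileAt` (an affine open `U ∋ 0`, sections `u₁,…,uₘ ∈ Γ(Y,U)` with germs in the maximal
ideal, positive antitone weights, `d > 0`, `X(U) ≤ (u^α : Σ wᵢαᵢ ≥ d)`) satisfies
`π ≤ (2,…,2,⊤,…)` (`n` twos): `admissibleProfileAt_fatPoint_le`. Proof: push the chart to the stalk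
`𝒪_{Y,0} = k[x]_{𝔪₀}` along the germ map (`map_germ_ofIdealTop_ideal`, `weightedMonomialIdeal_map`)
and apply `chartProfile_le_twoProfile_of_sq_le`. The cotangent-independence clause of the chart is
not used. Consequently the line's `plex`/`gen`/`hull` at the origin of `(𝔸ⁿ, 𝔪₀²)` is at most
`(2,…,2,⊤,…)` for every rule (`LexmaxHullRule.plex_fatPoint_le`).
-/

noncomputable section

open CategoryTheory AlgebraicGeometry
open Literature.AlgebraicGeometry.Resolution

set_option linter.dupNamespace false -- mandated namespace of this single-conjunct summit

namespace Summit.ResolutionOfSingularities.ResolutionOfSingularities.Theorems.PointwiseLexmaxHull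

/-- **Pushing a chart to the stalk.** If `π` is admissible for `X` at `y`, then in the local ring
`𝒪_{Y,y}` there are elements `v₁,…,vₘ` of the maximal ideal, positive antitone weights and `d > 0`
with `π = chartProfile d w`, such that for some affine open `U ∋ y` the germs of `X(U)` lie in the
weighted piece `(v^α : Σ wᵢαᵢ ≥ d)`. [OURS · folklore] -/
theorem AdmissibleProfileAt.exists_stalk {Y : Scheme.{0}} {X : Y.IdealSheafData} {y : Y}
    {π : Profile} (h : AdmissibleProfileAt X y π) :
    ∃ (U : Y.affineOpens) (hy : y ∈ (U : Y.Opens)) (m : ℕ) (v : Fin m → Y.presheaf.stalk y)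
      (w : Fin m → ℕ) (d : ℕ), (∀ i, 0 < w i) ∧ Antitone w ∧ 0 < d ∧
      (∀ i, v i ∈ IsLocalRing.maximalIdeal (Y.presheaf.stalk y)) ∧
      (X.ideal U).map (Y.presheaf.germ (U : Y.Opens) y hy).hom ≤ weightedMonomialIdeal v w d ∧
      π = chartProfile d w := by
  obtain ⟨U, hy, m, u, w, d, hw, hanti, hd, ⟨hgerm, -⟩, hle, rfl⟩ := h
  refine ⟨U, hy, m, fun i => (Y.presheaf.germ (U : Y.Opens) y hy).hom (u i), w, d, hw, hanti, hd,
    hgerm, ?_, rfl⟩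
  rw [← weightedMonomialIdeal_map]
  exact Ideal.map_mono hle

/-- **Fat-point bound, scheme form.** On `Spec k[x₁,…,xₙ]` with `X = 𝔪₀²` (ideal sheaf of the square
of the origin's maximal ideal), every profile admissible at the origin is `≤ (2,…,2,⊤,…)` (`n` twos).
[OURS · folklore] -/
theorem admissibleProfileAt_fatPoint_le (n : ℕ) (k : Type) [Field k] (π : Profile)
    (h : AdmissibleProfileAt
      (Scheme.IdealSheafData.ofIdealTop
        (((RingHom.ker (MvPolynomial.constantCoeff : MvPolynomial (Fin n) k →+* k)) ^ 2).map
          (Scheme.ΓSpecIso (.of (MvPolynomial (Fin n) k))).inv.hom))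
      (⟨RingHom.ker (MvPolynomial.constantCoeff : MvPolynomial (Fin n) k →+* k),
        RingHom.ker_isPrime _⟩ : Spec (.of (MvPolynomial (Fin n) k)))
      π) :
    π ≤ chartProfile (m := n) 2 (fun _ => 1) := by
  set A := MvPolynomial (Fin n) k with hA
  haveI h𝔪 : (RingHom.ker (MvPolynomial.constantCoeff : MvPolynomial (Fin n) k →+* k)).IsPrime :=
    RingHom.ker_isPrime _
  set y₀ : Spec (.of A) :=
    ⟨RingHom.ker (MvPolynomial.constantCoeff : MvPolynomial (Fin n) k →+* k), h𝔪⟩ with hy₀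
  obtain ⟨U, hy, m, v, w, d, hw, hanti, hd, hv, hle, rfl⟩ := h.exists_stalk
  letI : Algebra A ((Spec (.of A)).presheaf.stalk y₀) := StructureSheaf.stalkAlgebra A y₀
  haveI : IsLocalization.AtPrime ((Spec (.of A)).presheaf.stalk y₀) y₀.asIdeal :=
    StructureSheaf.IsLocalization.to_stalk A y₀
  refine chartProfile_le_twoProfile_of_sq_le (n := n) (k := k)
    (L := (Spec (.of A)).presheaf.stalk y₀) v hv w hw hanti d hd ?_
  -- the germs of `X(U)` generate `𝔪₀² 𝒪_{Y,0}`
  rw [map_germ_ofIdealTop_ideal, Ideal.map_map] at hle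
  have hcomp : ((Spec (CommRingCat.of A)).presheaf.germ ⊤ y₀ trivial).hom.comp
      (Scheme.ΓSpecIso (.of A)).inv.hom = algebraMap A ((Spec (.of A)).presheaf.stalk y₀) := by
    rfl
  rw [hcomp, Ideal.map_pow] at hle
  exact hle

/-- **Consequence for every rule**: the pointwise value `plex` of a `LexmaxHullRule` at the origin of
`(Spec k[x₁,…,xₙ], 𝔪₀²)` (a closed singular point, `k` perfect of characteristic `p`) is at most
`(2,…,2,⊤,…)` (`n` twos) — `plex` is itself admissible there (R2). [OURS · folklore] -/
theorem LexmaxHullRule.plex_fatPoint_le {p : ℕ} (R : LexmaxHullRule p) (n : ℕ) (k : Type) [Field k]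
    [CharP k p] [PerfectField k]
    [Smooth (Spec.map (CommRingCat.ofHom (algebraMap k (MvPolynomial (Fin n) k))))]
    [IsSeparated (Spec.map (CommRingCat.ofHom (algebraMap k (MvPolynomial (Fin n) k))))]
    [QuasiCompact (Spec.map (CommRingCat.ofHom (algebraMap k (MvPolynomial (Fin n) k))))]
    (hclosed : IsClosed ({(⟨RingHom.ker (MvPolynomial.constantCoeff : MvPolynomial (Fin n) k →+* k),
        RingHom.ker_isPrime _⟩ : Spec (.of (MvPolynomial (Fin n) k)))} :
        Set (Spec (.of (MvPolynomial (Fin n) k)))))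
    (hsing : XSing
      (Scheme.IdealSheafData.ofIdealTop
        (((RingHom.ker (MvPolynomial.constantCoeff : MvPolynomial (Fin n) k →+* k)) ^ 2).map
          (Scheme.ΓSpecIso (.of (MvPolynomial (Fin n) k))).inv.hom))
      (⟨RingHom.ker (MvPolynomial.constantCoeff : MvPolynomial (Fin n) k →+* k),
        RingHom.ker_isPrime _⟩ : Spec (.of (MvPolynomial (Fin n) k)))) :
    R.plex (Spec.map (CommRingCat.ofHom (algebraMap k (MvPolynomial (Fin n) k))))
      (Scheme.IdealSheafData.ofIdealTop
        (((RingHom.ker (MvPolynomial.constantCoeff : MvPolynomial (Fin n) k →+* k)) ^ 2).map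
          (Scheme.ΓSpecIso (.of (MvPolynomial (Fin n) k))).inv.hom))
      ⟨RingHom.ker (MvPolynomial.constantCoeff : MvPolynomial (Fin n) k →+* k),
        RingHom.ker_isPrime _⟩ ≤ chartProfile (m := n) 2 (fun _ => 1) :=
  admissibleProfileAt_fatPoint_le n k _ (R.plex_isGreatest _ _ _ hclosed hsing).1

end Summit.ResolutionOfSingularities.ResolutionOfSingularities.Theorems.PointwiseLexmaxHull

end
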